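import Mathlib
import Summits.ValiantsHypothesis.ValiantsHypothesis.Theorems.LiouvilleSarnakDigitalBilinearLiouvilleOddTwinTruncation

/-!
# Route LiouvilleSarnak — crux `DigitalBilinearLiouville` (stmt-ValiantsHypothesis-14774): twisting a bilinear form by
# the two-adic sign (route-independent core inequality, part 2 of 3)

* `sum_norm_filter_le` — Cauchy–Schwarz `Σ_{x ∈ A} ‖u x‖ ≤ √#A · ‖u‖₂`.
* ★ `twist_bilinear_le` — THE CORE INEQUALITY: for a cut `π` at level `n`, `K < n`, and any entries `G` with
  `‖G_{rc}‖ ≤ 1` whose bilinear forms satisfy `‖Σ u_r w_c G_{rc}‖ ≤ β ‖u‖₂ ‖w‖₂` for all test vectors, the entries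
  twisted by `f₀(N_π(r,c)+1) = (-1)^{v₂(N+1)}` satisfy `‖Σ u_r w_c G_{rc} f₀‖ ≤ ((4K+1) β + 2 · 2^{n-K}) ‖u‖₂ ‖w‖₂`:
  truncate the expansion of `f₀` at `2K` (`…OddTwinTruncation.twoAdicSign_cut_truncate`) — `4K+1` restricted
  bilinear forms of `G` — and bound the remainder, supported on the `2^{2n-2K-1}` pairs with `2K+1` forced low bits
  (`card_filter_forced`, `card_forced_add`), by Cauchy–Schwarz.

Honest framing: a tool; no claim about the cruxes; nothing bears on `VP ≠ VNP`.  No definitions.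
-/

set_option linter.dupNamespace false

noncomputable section

namespace Summit.ValiantsHypothesis.ValiantsHypothesis.Theorems.LiouvilleSarnakDigitalBilinearLiouville.OddTwinCore

open ArithmeticFunction Finset

open Summit.ValiantsHypothesis.ValiantsHypothesis.Theorems.LiouvilleSarnakDigitalBilinearLiouville.OddTwinTruncation
  (twoAdicSign_cut_truncate card_filter_forced card_forced_add)

/-! ### §3 The core inequality -/

/-- Cauchy–Schwarz on a filtered sum of norms: `Σ_{x ∈ A} ‖u x‖ ≤ √#A · √(Σ_x ‖u x‖²)`. [folklore] -/
theorem sum_norm_filter_le {ι : Type*} [Fintype ι] [DecidableEq ι] (A : Finset ι) (u : ι → ℂ) :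
    ∑ x ∈ A, ‖u x‖ ≤ Real.sqrt A.card * Real.sqrt (∑ x, ‖u x‖ ^ 2) := by
  have hcs := Finset.sum_mul_sq_le_sq_mul_sq A (fun _ => (1 : ℝ)) (fun x => ‖u x‖)
  simp only [one_mul, one_pow, sum_const, nsmul_eq_mul, mul_one] at hcs
  have hA : ∑ x ∈ A, ‖u x‖ ^ 2 ≤ ∑ x, ‖u x‖ ^ 2 :=
    Finset.sum_le_sum_of_subset_of_nonneg (Finset.subset_univ A) fun _ _ _ => by positivity
  have h0 : 0 ≤ ∑ x ∈ A, ‖u x‖ := Finset.sum_nonneg fun _ _ => norm_nonneg _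
  rw [← Real.sqrt_mul (Nat.cast_nonneg _), Real.le_sqrt h0 (by positivity)]
  exact hcs.trans (mul_le_mul_of_nonneg_left hA (Nat.cast_nonneg _))

/-- ★ **Twisting by the two-adic sign costs `(4K+1) β + 2^{n-K+1}`.**  Let `π` be a cut of the `2n` positions,
`K < n`, and `G` any array of entries with `‖G_{rc}‖ ≤ 1` whose bilinear forms are bounded by `β ‖u‖ ‖w‖`.  Then
the bilinear forms of the twisted entries `G_{rc} · (-1)^{v₂(N_π(r,c)+1)}` are bounded by
`((4K+1) β + 2 · 2^{n-K}) ‖u‖ ‖w‖`. [this file] -/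
theorem twist_bilinear_le (n K : ℕ) (hKn : K < n) (π : Fin n ⊕ Fin n ≃ Fin (2 * n))
    (G : (Fin n → Bool) → (Fin n → Bool) → ℂ) (hG1 : ∀ r c, ‖G r c‖ ≤ 1) (β : ℝ) (hβ0 : 0 ≤ β)
    (hβ : ∀ u w : (Fin n → Bool) → ℂ,
      ‖∑ r, ∑ c, u r * w c * G r c‖ ≤
        β * Real.sqrt (∑ r, ‖u r‖ ^ 2) * Real.sqrt (∑ c, ‖w c‖ ^ 2))
    (u w : (Fin n → Bool) → ℂ) :
    ‖∑ r, ∑ c, u r * w c *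
        (G r c * (-1 : ℂ) ^ ((Nat.ofBits (fun k : Fin (2 * n) => Sum.elim r c (π.symm k)) + 1).factorization 2))‖ ≤
      ((4 * K + 1) * β + 2 * 2 ^ (n - K)) * Real.sqrt (∑ r, ‖u r‖ ^ 2) * Real.sqrt (∑ c, ‖w c‖ ^ 2) := by
  classical
  have hK : 2 * K + 1 ≤ 2 * n := by omega
  -- notation
  set PR : ℕ → (Fin n → Bool) → Prop := fun j r => ∀ i : Fin n, (π (Sum.inl i) : ℕ) < j → r i = true with hPR
  set PC : ℕ → (Fin n → Bool) → Prop := fun j c => ∀ i : Fin n, (π (Sum.inr i) : ℕ) < j → c i = true with hPC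
  set F : (Fin n → Bool) → (Fin n → Bool) → ℂ := fun r c =>
    (-1 : ℂ) ^ ((Nat.ofBits (fun k : Fin (2 * n) => Sum.elim r c (π.symm k)) + 1).factorization 2) with hF
  set Tr : (Fin n → Bool) → (Fin n → Bool) → ℂ := fun r c =>
    1 + 2 * ∑ j ∈ Icc 1 (2 * K), (-1 : ℂ) ^ j * (if PR j r ∧ PC j c then 1 else 0) with hTr
  set U := Real.sqrt (∑ r, ‖u r‖ ^ 2) with hU
  set V := Real.sqrt (∑ c, ‖w c‖ ^ 2) with hV
  have hU0 : 0 ≤ U := Real.sqrt_nonneg _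
  have hV0 : 0 ≤ V := Real.sqrt_nonneg _
  -- the truncation facts, pointwise
  have htrunc : ∀ r c, (¬ (PR (2 * K + 1) r ∧ PC (2 * K + 1) c) → F r c = Tr r c) ∧ ‖F r c - Tr r c‖ ≤ 2 := by
    intro r c
    have h := twoAdicSign_cut_truncate n K hK π r c
    exact h
  -- restricted test vectors
  set uj : ℕ → (Fin n → Bool) → ℂ := fun j r => if PR j r then u r else 0 with huj
  set wj : ℕ → (Fin n → Bool) → ℂ := fun j c => if PC j c then w c else 0 with hwj
  have huj_le : ∀ j, Real.sqrt (∑ r, ‖uj j r‖ ^ 2) ≤ U := by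
    intro j
    apply Real.sqrt_le_sqrt
    refine sum_le_sum fun r _ => ?_
    simp only [huj]; split_ifs <;> simp
  have hwj_le : ∀ j, Real.sqrt (∑ c, ‖wj j c‖ ^ 2) ≤ V := by
    intro j
    apply Real.sqrt_le_sqrt
    refine sum_le_sum fun c _ => ?_
    simp only [hwj]; split_ifs <;> simp
  -- (1) decomposition of the main part
  have hmain : ∑ r, ∑ c, u r * w c * (G r c * Tr r c) =
      (∑ r, ∑ c, u r * w c * G r c) +
        2 * ∑ j ∈ Icc 1 (2 * K), (-1 : ℂ) ^ j * ∑ r, ∑ c, uj j r * wj j c * G r c := by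
    have hterm : ∀ r c, u r * w c * (G r c * Tr r c) =
        u r * w c * G r c +
          ∑ j ∈ Icc 1 (2 * K), 2 * ((-1 : ℂ) ^ j * (uj j r * wj j c * G r c)) := by
      intro r c
      have hj : ∀ j, 2 * ((-1 : ℂ) ^ j * (uj j r * wj j c * G r c)) =
          (u r * w c * G r c) * (2 * ((-1 : ℂ) ^ j * (if PR j r ∧ PC j c then 1 else 0))) := by
        intro j
        simp only [huj, hwj]
        by_cases h1 : PR j r
        · by_cases h2 : PC j c
          · simp only [h1, h2, and_self, if_true]
            ring
          · simp [h1, h2]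
        · simp [h1]
      simp_rw [hj]
      rw [← Finset.mul_sum, ← Finset.mul_sum]
      simp only [hTr]
      ring
    have hL : ∑ r, ∑ c, u r * w c * (G r c * Tr r c) =
        (∑ r, ∑ c, u r * w c * G r c) +
          ∑ r, ∑ c, ∑ j ∈ Icc 1 (2 * K), 2 * ((-1 : ℂ) ^ j * (uj j r * wj j c * G r c)) := by
      rw [← sum_add_distrib]
      refine sum_congr rfl fun r _ => ?_
      rw [← sum_add_distrib]
      exact sum_congr rfl fun c _ => hterm r c
    rw [hL]
    congr 1
    calc ∑ r, ∑ c, ∑ j ∈ Icc 1 (2 * K), 2 * ((-1 : ℂ) ^ j * (uj j r * wj j c * G r c))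
        = ∑ r, ∑ j ∈ Icc 1 (2 * K), ∑ c, 2 * ((-1 : ℂ) ^ j * (uj j r * wj j c * G r c)) :=
          sum_congr rfl fun r _ => Finset.sum_comm
      _ = ∑ j ∈ Icc 1 (2 * K), ∑ r, ∑ c, 2 * ((-1 : ℂ) ^ j * (uj j r * wj j c * G r c)) := Finset.sum_comm
      _ = 2 * ∑ j ∈ Icc 1 (2 * K), (-1 : ℂ) ^ j * ∑ r, ∑ c, uj j r * wj j c * G r c := by
          rw [Finset.mul_sum]
          refine sum_congr rfl fun j _ => ?_
          simp only [← Finset.mul_sum]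
  -- (2) the remainder
  have hsplit : ∑ r, ∑ c, u r * w c * (G r c * F r c) =
      (∑ r, ∑ c, u r * w c * (G r c * Tr r c)) + ∑ r, ∑ c, u r * w c * (G r c * (F r c - Tr r c)) := by
    rw [← sum_add_distrib]
    refine sum_congr rfl fun r _ => ?_
    rw [← sum_add_distrib]
    refine sum_congr rfl fun c _ => ?_
    ring
  -- bound on the remainder: supported on the forced pairs
  set AR := Finset.univ.filter fun r : Fin n → Bool => PR (2 * K + 1) r with hAR
  set AC := Finset.univ.filter fun c : Fin n → Bool => PC (2 * K + 1) c with hAC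
  set a1 : (Fin n → Bool) → ℝ := fun r => if PR (2 * K + 1) r then ‖u r‖ else 0 with ha1
  set b1 : (Fin n → Bool) → ℝ := fun c => if PC (2 * K + 1) c then ‖w c‖ else 0 with hb1
  have ha1_sum : ∑ r, a1 r = ∑ r ∈ AR, ‖u r‖ := by rw [hAR, Finset.sum_filter]
  have hb1_sum : ∑ c, b1 c = ∑ c ∈ AC, ‖w c‖ := by rw [hAC, Finset.sum_filter]
  have hrem : ‖∑ r, ∑ c, u r * w c * (G r c * (F r c - Tr r c))‖ ≤
      2 * ((∑ r ∈ AR, ‖u r‖) * (∑ c ∈ AC, ‖w c‖)) := by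
    rw [← ha1_sum, ← hb1_sum, Finset.sum_mul_sum, Finset.mul_sum]
    calc ‖∑ r, ∑ c, u r * w c * (G r c * (F r c - Tr r c))‖
        ≤ ∑ r, ‖∑ c, u r * w c * (G r c * (F r c - Tr r c))‖ := norm_sum_le _ _
      _ ≤ ∑ r, ∑ c, ‖u r * w c * (G r c * (F r c - Tr r c))‖ := sum_le_sum fun r _ => norm_sum_le _ _
      _ ≤ ∑ r, 2 * ∑ c, a1 r * b1 c := by
          refine sum_le_sum fun r _ => ?_
          rw [Finset.mul_sum]
          refine sum_le_sum fun c _ => ?_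
          by_cases hP : PR (2 * K + 1) r ∧ PC (2 * K + 1) c
          · simp only [ha1, hb1, if_pos hP.1, if_pos hP.2, norm_mul]
            have h2 := (htrunc r c).2
            have hG := hG1 r c
            have hu0 := norm_nonneg (u r)
            have hw0 := norm_nonneg (w c)
            calc ‖u r‖ * ‖w c‖ * (‖G r c‖ * ‖F r c - Tr r c‖)
                ≤ ‖u r‖ * ‖w c‖ * (1 * 2) := by gcongr
              _ = 2 * (‖u r‖ * ‖w c‖) := by ring
          · rw [(htrunc r c).1 hP, sub_self, mul_zero, mul_zero, norm_zero]
            have : 0 ≤ a1 r * b1 c := by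
              simp only [ha1, hb1]; split_ifs <;> positivity
            linarith
  -- sizes of the forced sets
  have hcardR : AR.card = 2 ^ (n - (Finset.univ.filter fun i : Fin n => (π (Sum.inl i) : ℕ) < 2 * K + 1).card) := by
    have := card_filter_forced n (Finset.univ.filter fun i : Fin n => (π (Sum.inl i) : ℕ) < 2 * K + 1)
    simp only [mem_filter, mem_univ, true_and] at this
    rw [hAR]
    exact this
  have hcardC : AC.card = 2 ^ (n - (Finset.univ.filter fun i : Fin n => (π (Sum.inr i) : ℕ) < 2 * K + 1).card) := by
    have := card_filter_forced n (Finset.univ.filter fun i : Fin n => (π (Sum.inr i) : ℕ) < 2 * K + 1)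
    simp only [mem_filter, mem_univ, true_and] at this
    rw [hAC]
    exact this
  have hab := card_forced_add n π (2 * K + 1) hK
  set a := (Finset.univ.filter fun i : Fin n => (π (Sum.inl i) : ℕ) < 2 * K + 1).card with ha
  set b := (Finset.univ.filter fun i : Fin n => (π (Sum.inr i) : ℕ) < 2 * K + 1).card with hb
  have ha_le : a ≤ n := by
    rw [ha]; exact (card_filter_le _ _).trans (by simp)
  have hb_le : b ≤ n := by
    rw [hb]; exact (card_filter_le _ _).trans (by simp)
  have hprod : (AR.card : ℝ) * AC.card ≤ ((2 : ℝ) ^ (n - K)) ^ 2 := by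
    rw [hcardR, hcardC]
    push_cast
    rw [← pow_add, ← pow_mul]
    exact pow_le_pow_right₀ (by norm_num) (by omega)
  have hrem' : ‖∑ r, ∑ c, u r * w c * (G r c * (F r c - Tr r c))‖ ≤ 2 * 2 ^ (n - K) * U * V := by
    refine hrem.trans ?_
    have h1 := sum_norm_filter_le AR u
    have h2 := sum_norm_filter_le AC w
    rw [← hU] at h1
    rw [← hV] at h2
    have h3 : Real.sqrt AR.card * Real.sqrt AC.card ≤ 2 ^ (n - K) := by
      rw [← Real.sqrt_mul (Nat.cast_nonneg _), Real.sqrt_le_left (by positivity)]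
      exact hprod
    have h4 : (∑ r ∈ AR, ‖u r‖) * (∑ c ∈ AC, ‖w c‖) ≤ (Real.sqrt AR.card * U) * (Real.sqrt AC.card * V) :=
      mul_le_mul h1 h2 (Finset.sum_nonneg fun _ _ => norm_nonneg _) (by positivity)
    calc 2 * ((∑ r ∈ AR, ‖u r‖) * (∑ c ∈ AC, ‖w c‖))
        ≤ 2 * ((Real.sqrt AR.card * U) * (Real.sqrt AC.card * V)) := by linarith
      _ = 2 * (Real.sqrt AR.card * Real.sqrt AC.card) * U * V := by ring
      _ ≤ 2 * 2 ^ (n - K) * U * V := by gcongr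
  -- bound on the main part
  have hmain' : ‖∑ r, ∑ c, u r * w c * (G r c * Tr r c)‖ ≤ (4 * K + 1) * β * U * V := by
    rw [hmain]
    refine (norm_add_le _ _).trans ?_
    have h0 : ‖∑ r, ∑ c, u r * w c * G r c‖ ≤ β * U * V := hβ u w
    have hj : ∀ j, ‖∑ r, ∑ c, uj j r * wj j c * G r c‖ ≤ β * U * V := by
      intro j
      refine (hβ (uj j) (wj j)).trans ?_
      have := huj_le j
      have := hwj_le j
      gcongr
    have h1 : ‖2 * ∑ j ∈ Icc 1 (2 * K), (-1 : ℂ) ^ j * ∑ r, ∑ c, uj j r * wj j c * G r c‖ ≤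
        2 * ((2 * K) * (β * U * V)) := by
      rw [norm_mul, Complex.norm_ofNat]
      refine mul_le_mul_of_nonneg_left ?_ (by norm_num)
      refine (norm_sum_le _ _).trans ?_
      calc ∑ j ∈ Icc 1 (2 * K), ‖(-1 : ℂ) ^ j * ∑ r, ∑ c, uj j r * wj j c * G r c‖
          ≤ ∑ _j ∈ Icc 1 (2 * K), β * U * V := by
            refine sum_le_sum fun j _ => ?_
            rw [norm_mul, norm_pow, norm_neg, norm_one, one_pow, one_mul]
            exact hj j
        _ = (2 * K) * (β * U * V) := by
            rw [sum_const, Nat.card_Icc, nsmul_eq_mul]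
            push_cast
            ring
    calc ‖∑ r, ∑ c, u r * w c * G r c‖ +
          ‖2 * ∑ j ∈ Icc 1 (2 * K), (-1 : ℂ) ^ j * ∑ r, ∑ c, uj j r * wj j c * G r c‖
        ≤ β * U * V + 2 * ((2 * K) * (β * U * V)) := add_le_add h0 h1
      _ = (4 * K + 1) * β * U * V := by ring
  -- assemble
  have hfinal : ‖∑ r, ∑ c, u r * w c * (G r c * F r c)‖ ≤
      ((4 * K + 1) * β + 2 * 2 ^ (n - K)) * U * V := by
    rw [hsplit]
    refine (norm_add_le _ _).trans ?_
    calc _ ≤ (4 * K + 1) * β * U * V + 2 * 2 ^ (n - K) * U * V := add_le_add hmain' hrem'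
      _ = ((4 * K + 1) * β + 2 * 2 ^ (n - K)) * U * V := by ring
  simpa only [hF] using hfinal

end Summit.ValiantsHypothesis.ValiantsHypothesis.Theorems.LiouvilleSarnakDigitalBilinearLiouville.OddTwinCore

end
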